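import Summits.CriticalPhenomena.PercolationContinuityZ3.Theorems.PercNearOneGluingNoHeavyQuantGateMoveBlob
import HarnessLib

/-!
# QUANT lane R8, T-DEC, leg (III): the blob gate move (M) REDUCED TO GATED TWO-POINT CELLS —
# finite mixtures at a common target (`decAtT_mixture_finset`), linearity of the slice, and
# **`decAtT_gateMoveBlob_of_cells`**: (M) for an arbitrary top-affordable law `ν` follows from (M) for the laws `TP[lo, hi; γ]` of the SAME mean

builds on p205010 (kernel theorem, internal audit signed; external expert review pending)

Support file (`--supports stmt-CriticalPhenomena-4575`), QUANT lane lead seat prim-quant-lead (gen 30), rung R8 of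
`run/shared/lean/prim/quant/LADDER.md`.  Theorems only (no definitions), standard axioms, no sorries.  Continues typer g27's
`…QuantGateMoveBlob` (the move lemma (M): `decAtT_gateMoveBlob`), arm-1 g39's `…QuantTwinMove` (`TwinMoveDEC`, `twinMove_of_lt`) and Lemma P
(`exists_twoPoint_decomposition_TA`, typer g18).  Memo `run/shared/lean/prim/quant/FOR-PROVERS-R2.md` (lead g30, README V315).

THE REDUCTION.  In the move lemma (M) — `ν` a top-affordable probability law on `{0..M}` with mean `S`, `0 ≤ z ≤ ν 0`, blob `{0, a; g}`,
`P := slice ν a g + g·z·(δ₀ − δ_a)` at the target `t := S + ag − zag` — the conclusion law is AFFINE in `ν` once the zero atom is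
split off: with `ν = z·δ₀ + (1 − z)·ν̂` one has `P = z·δ₀ + (1 − z)·slice ν̂ a g` (`gateMove_eq_gate_slice`), `ν̂` is a probability law
with mean `Ŝ = S/(1−z)`, and `t = (1 − z)(Ŝ + ag)` depends on `ν̂` only through its mean.  Lemma P writes `ν̂` as a finite mixture of
one- and two-point laws `TP[lo, hi; γ]` of the SAME mean `Ŝ` (`lo ≤ hi ≤ M`); the slice is linear (`slice_sum_TP`); DEC at a fixed
`(y, t, j, M + a)` is preserved under finite mixtures (`decAtT_mixture_finset`).  HENCE (`decAtT_gateMoveBlob_of_cells`): if the GATED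
TWO-POINT CELLS `z·δ₀ + (1 − z)·slice TP[lo, hi; γ] a g` with `(1 − z)(lo + (hi − lo)γ) = S` are DEC at `(y, t, j, M + a)`, then so is
`P` — for EVERY law `ν` of mean `S` with `ν 0 ≥ z`, with NO hypothesis on `Λ = slice ν a g`.
USE (README V315, FOR-PROVERS-R2): in the regime `t ≤ 2a` (the blob atom `a` is a `t`-mid; arm-1's residual (R2)) the cells are DEC from
top-affordability `y·M ≤ S` and the threshold `y ≤ (1 − z)g` ALONE (exact censuses: 0 / 9 000 cell instances, 0 / 11 500 general laws; lead
g30 explore/t8–t13, kit j170627) — so (M), hence `TwinMoveDEC`'s conclusion for slices, is HYPOTHESIS-FREE there, exactly as for the layers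
`j < a` (`twinMove_of_lt`); the cells (one blob unit; blob unit + free atom; two blob units) are the remaining kernel work (next arm-1 seat).
In the regime `2a < t` the cells are NOT all DEC without the hypothesis on `Λ` and the reduction is not the route ((R1), typer line).

* `LawDec.decAtT_congr` — DEC depends on the law only through its values.
* `LawDec.decAtT_mixture_finset` — finite mixtures at a common `(x, T, j′, M)` (from `decAtT_mixture` by induction).
* `LawDec.slice_sum_TP` — the slice of a finite mixture of two-point laws is the mixture of their slices.
* `LawDec.gateMove_eq_gate_slice` — `slice ν a g + gz(δ₀ − δ_a) = z·δ₀ + (1−z)·slice ν̂ a g`.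
* **`LawDec.decAtT_gateMoveBlob_of_cells`** — the reduction.

HONEST STATUS: a reduction, no cell is proved here; (M)/`TwinMoveDEC`, `GateMove`, `GatedConvEmptyFree`, `SingleGateConvClosed`, `TreeDEC`,
`FarTreeRow` remain OPEN; the RATE class log\* and the honest sentence of `run/shared/lean/prim/quant/README.md` are unchanged.

[this work]; (M): prim-quant-stmt g27; `TwinMoveDEC`: prim-quant-arm-1 g39; Lemma P: prim-quant-stmt g18 (this lane).  Nothing here is cited
as a published result.  The gluing rows served [cite: KozmaNitzan2024, Conjecture 3 (p. 15)]; product measure [cite: Grimmett1999, §1.3 p. 10].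
-/

noncomputable section

namespace Summit.CriticalPhenomena.PercolationContinuityZ3.Theorems

namespace Quant

open Finset

/-- the two-point law `{lo, hi; g}` (as in `…QuantLawDEC`) -/
local notation3 "TP[" lo ", " hi ", " g ", " h "]" =>
  (g : ℝ) * (if (h : ℕ) = (hi : ℕ) then (1 : ℝ) else 0) + (1 - (g : ℝ)) * (if (h : ℕ) = (lo : ℕ) then (1 : ℝ) else 0)

namespace LawDec

/-! ### Generic tools -/

/-- DEC at an explicit target depends on the law only through its values. [this work] -/
theorem decAtT_congr {x T : ℝ} {j' M : ℕ} {μ μ' : ℕ → ℝ} (hμ : ∀ h, μ h = μ' h) (hdec : DECAtT x T j' M μ) :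
    DECAtT x T j' M μ' := by
  have : μ = μ' := funext hμ
  rw [← this]; exact hdec

/-- **Finite mixtures at a common target**: `0 ≤ w`, `Σ_{i ∈ s} w i = 1`, and every `μ i` with `w i > 0` DEC at `(x, T, j′, M)` ⟹ the mixture
`Σ_{i ∈ s} w i · μ i` is DEC there.  (Induction on `s` with `decAtT_mixture`.) [this work] -/
theorem decAtT_mixture_finset {ι : Type*} {x T : ℝ} {j' M : ℕ} (s : Finset ι) (w : ι → ℝ) (μ : ι → ℕ → ℝ)
    (hw0 : ∀ i ∈ s, 0 ≤ w i) (hw1 : ∑ i ∈ s, w i = 1) (hdec : ∀ i ∈ s, 0 < w i → DECAtT x T j' M (μ i)) :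
    DECAtT x T j' M (fun h => ∑ i ∈ s, w i * μ i h) := by
  classical
  -- generalised statement: for every sub-family with positive total weight `W`, the normalised mixture is DEC
  suffices key : ∀ (s : Finset ι), (∀ i ∈ s, 0 ≤ w i) → (∀ i ∈ s, 0 < w i → DECAtT x T j' M (μ i)) →
      0 < ∑ i ∈ s, w i → DECAtT x T j' M (fun h => ∑ i ∈ s, (w i / ∑ k ∈ s, w k) * μ i h) by
    have h := key s hw0 hdec (by rw [hw1]; exact one_pos)
    refine decAtT_congr (fun h => ?_) h
    rw [hw1]; simp only [div_one]
  intro s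
  induction s using Finset.induction_on with
  | empty => intro _ _ hpos; simp at hpos
  | @insert i s hi IH =>
    intro hw0 hdec hpos
    have hwi : 0 ≤ w i := hw0 i (Finset.mem_insert_self i s)
    have hw0' : ∀ k ∈ s, 0 ≤ w k := fun k hk => hw0 k (Finset.mem_insert_of_mem hk)
    have hdec' : ∀ k ∈ s, 0 < w k → DECAtT x T j' M (μ k) := fun k hk => hdec k (Finset.mem_insert_of_mem hk)
    set W := ∑ k ∈ insert i s, w k with hW
    have hWsplit : W = w i + ∑ k ∈ s, w k := by rw [hW, Finset.sum_insert hi]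
    have hWs0 : 0 ≤ ∑ k ∈ s, w k := Finset.sum_nonneg hw0'
    by_cases hs0 : ∑ k ∈ s, w k = 0
    · -- all the weight sits on `i`
      have hwk0 : ∀ k ∈ s, w k = 0 := fun k hk => (Finset.sum_eq_zero_iff_of_nonneg hw0').1 hs0 k hk
      have hWi : W = w i := by rw [hWsplit, hs0, add_zero]
      have hwipos : 0 < w i := by rw [← hWi]; exact hpos
      refine decAtT_congr (fun h => ?_) (hdec i (Finset.mem_insert_self i s) hwipos)
      rw [Finset.sum_insert hi, hWi, div_self hwipos.ne', one_mul]
      rw [Finset.sum_eq_zero (fun k hk => by rw [hwk0 k hk, zero_div, zero_mul]), add_zero]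
    · have hWspos : 0 < ∑ k ∈ s, w k := lt_of_le_of_ne hWs0 (Ne.symm hs0)
      have hWpos : 0 < W := hpos
      -- the tail, normalised, is DEC by induction
      have hIH := IH hw0' hdec' hWspos
      set p : ℝ := w i / W with hp
      have hp0 : 0 ≤ p := div_nonneg hwi hWpos.le
      have hp1 : p ≤ 1 := by
        rw [hp, div_le_one hWpos, hWsplit]; linarith
      have h1p : 1 - p = (∑ k ∈ s, w k) / W := by
        rw [hp, eq_div_iff hWpos.ne', sub_mul, div_mul_cancel₀ _ hWpos.ne', one_mul, hWsplit]; ring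
      by_cases hwi0 : w i = 0
      · -- the head carries no weight: the mixture is the tail's
        refine decAtT_congr (fun h => ?_) hIH
        rw [Finset.sum_insert hi, hwi0, zero_div, zero_mul, zero_add]
        refine Finset.sum_congr rfl fun k _ => ?_
        rw [hWsplit, hwi0, zero_add]
      · have hwipos : 0 < w i := lt_of_le_of_ne hwi (Ne.symm hwi0)
        have hmix := decAtT_mixture p hp0 hp1 (hdec i (Finset.mem_insert_self i s) hwipos) hIH
        refine decAtT_congr (fun h => ?_) hmix
        rw [Finset.sum_insert hi, h1p, Finset.mul_sum]
        congr 1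
        refine Finset.sum_congr rfl fun k _ => ?_
        rw [← mul_assoc]
        congr 1
        rw [div_mul_div_comm, mul_comm (∑ k ∈ s, w k), ← div_mul_div_comm, div_self hWspos.ne', mul_one]

/-- **the slice is linear**: the slice of a finite mixture of two-point laws is the mixture of the slices. [this work] -/
theorem slice_sum_TP {ι : Type*} (s : Finset ι) (w g' : ι → ℝ) (lo hi : ι → ℕ) (a : ℕ) (g : ℝ) (h : ℕ) :
    slice (fun k => ∑ i ∈ s, w i * TP[lo i, hi i, g' i, k]) a g h
      = ∑ i ∈ s, w i * slice (fun k => TP[lo i, hi i, g' i, k]) a g h := by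
  simp only [slice]
  split_ifs with hah
  · rw [Finset.mul_sum, Finset.mul_sum, ← Finset.sum_add_distrib]
    refine Finset.sum_congr rfl fun i _ => ?_
    ring
  · simp only [mul_zero, add_zero]
    rw [Finset.mul_sum]
    refine Finset.sum_congr rfl fun i _ => ?_
    ring

/-- **splitting off the zero atom**: with `ν̂ h = (ν h − z·[h = 0])/(1 − z)` (`z < 1`),
`slice ν a g h + g z ([h=0] − [h=a]) = z·[h = 0] + (1 − z)·slice ν̂ a g h` (`a ≥ 1`). [this work] -/
theorem gateMove_eq_gate_slice (ν : ℕ → ℝ) (a : ℕ) (g z : ℝ) (ha : 1 ≤ a) (hz1 : z < 1) (h : ℕ) :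
    slice ν a g h + g * z * ((if h = 0 then (1 : ℝ) else 0) - (if h = a then (1 : ℝ) else 0))
      = z * (if h = 0 then (1 : ℝ) else 0)
        + (1 - z) * slice (fun k => (ν k - z * (if k = 0 then (1 : ℝ) else 0)) / (1 - z)) a g h := by
  have h1z : (1 : ℝ) - z ≠ 0 := by linarith
  simp only [slice]
  by_cases h0 : h = 0
  · subst h0
    have hna : ¬ a ≤ 0 := by omega
    have hna' : (0 : ℕ) ≠ a := by omega
    simp only [if_true, if_neg hna, if_neg hna']
    field_simp
    ring
  · simp only [if_neg h0]
    by_cases hah : a ≤ h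
    · simp only [if_pos hah]
      by_cases hha : h = a
      · subst hha
        simp only [Nat.sub_self, if_true]
        field_simp
        ring
      · have hsub : h - a ≠ 0 := by omega
        simp only [if_neg hha, if_neg hsub]
        field_simp
        ring
    · have hha : h ≠ a := by omega
      simp only [if_neg hah, if_neg hha]
      field_simp
      ring

/-! ### The reduction -/

/-- **(M) FROM GATED TWO-POINT CELLS.**  `z < 1`, `z ≤ ν 0`, `g ≤ 1`, `1 ≤ a`; `ν ≥ 0` a probability law on `{0..M}`
with mean `S`.  If for every two-point (or one-point) law `TP[lo, hi; γ]` (`lo ≤ hi ≤ M`, `0 ≤ γ ≤ 1`) of gated mean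
`(1 − z)(lo + (hi − lo)γ) = S` the cell `z·δ₀ + (1 − z)·slice TP[lo, hi; γ] a g` is `DECAtT y (S + ag − zag) j (M + a)`, then the
moved slice `slice ν a g + g·z·(δ₀ − δ_a)` is `DECAtT y (S + ag − zag) j (M + a)` — the conclusion of typer g27's `decAtT_gateMoveBlob`,
with NO hypothesis on `slice ν a g` and no support hypothesis.  (Lemma P on `ν̂ = (ν − zδ₀)/(1−z)` + `slice_sum_TP` + `decAtT_mixture_finset`.)
[this work] -/
theorem decAtT_gateMoveBlob_of_cells (y z g S : ℝ) (a j M : ℕ) (ν : ℕ → ℝ)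
    (hz1 : z < 1) (ha : 1 ≤ a)
    (hν0 : ∀ h, 0 ≤ ν h) (hνM : ∀ h, M < h → ν h = 0) (hν1 : ∑ h ∈ Finset.range (M + 1), ν h = 1)
    (hS : S = ∑ h ∈ Finset.range (M + 1), (h : ℝ) * ν h) (hzν : z ≤ ν 0)
    (hcell : ∀ (lo hi : ℕ) (γ : ℝ), lo ≤ hi → hi ≤ M → 0 ≤ γ → γ ≤ 1 →
      (1 - z) * ((lo : ℝ) + ((hi : ℝ) - lo) * γ) = S →
      DECAtT y (S + (a : ℝ) * g - z * (a : ℝ) * g) j (M + a)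
        (fun h => z * (if h = 0 then (1 : ℝ) else 0) + (1 - z) * slice (fun k => TP[lo, hi, γ, k]) a g h)) :
    DECAtT y (S + (a : ℝ) * g - z * (a : ℝ) * g) j (M + a)
      (fun h => slice ν a g h + g * z * ((if h = 0 then (1 : ℝ) else 0) - (if h = a then (1 : ℝ) else 0))) := by
  classical
  have h1z : 0 < 1 - z := by linarith
  -- the law `ν̂`
  set νh : ℕ → ℝ := fun k => (ν k - z * (if k = 0 then (1 : ℝ) else 0)) / (1 - z) with hνh
  have hνh0 : ∀ k, 0 ≤ νh k := by
    intro k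
    simp only [hνh]
    refine div_nonneg ?_ h1z.le
    by_cases hk : k = 0
    · subst hk; simp; linarith
    · simp [hk]; exact hν0 k
  have hνhM : ∀ k, M < k → νh k = 0 := by
    intro k hk
    have hk0 : k ≠ 0 := by omega
    simp only [hνh, hνM k hk, if_neg hk0, mul_zero, sub_zero, zero_div]
  have hνh1 : ∑ k ∈ Finset.range (M + 1), νh k = 1 := by
    simp only [hνh]
    rw [← Finset.sum_div, Finset.sum_sub_distrib, hν1, ← Finset.mul_sum,
      Finset.sum_ite_eq' (Finset.range (M + 1)) 0 (fun _ => (1 : ℝ)), if_pos (Finset.mem_range.2 (Nat.succ_pos M))]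
    rw [mul_one, div_self h1z.ne']
  have hνhmean : ∑ k ∈ Finset.range (M + 1), (k : ℝ) * νh k = S / (1 - z) := by
    simp only [hνh]
    have : ∀ k ∈ Finset.range (M + 1), (k : ℝ) * ((ν k - z * (if k = 0 then (1 : ℝ) else 0)) / (1 - z))
        = ((k : ℝ) * ν k) / (1 - z) := by
      intro k _
      by_cases hk : k = 0
      · subst hk; simp
      · simp [hk]; ring
    rw [Finset.sum_congr rfl this, ← Finset.sum_div, ← hS]
  -- Lemma P for `ν̂` (top-affordability at floor `0` is free)
  obtain ⟨lam, gg, lo, hi, hl0, hl1, hgg, hlohi, hhi, hdecomp, hgen⟩ :=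
    exists_twoPoint_decomposition_TA M M le_rfl νh hνh0 hνhM hνh1 0 (fun k _ => by
      rw [zero_mul]; exact Finset.sum_nonneg fun i _ => mul_nonneg (Nat.cast_nonneg i) (hνh0 i))
  -- the conclusion law as a mixture of cells
  have hP : ∀ h, slice ν a g h + g * z * ((if h = 0 then (1 : ℝ) else 0) - (if h = a then (1 : ℝ) else 0))
      = ∑ r, lam r * (z * (if h = 0 then (1 : ℝ) else 0) + (1 - z) * slice (fun k => TP[lo r, hi r, gg r, k]) a g h) := by
    intro h
    rw [gateMove_eq_gate_slice ν a g z ha hz1 h]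
    have hsl : slice νh a g h = ∑ r, lam r * slice (fun k => TP[lo r, hi r, gg r, k]) a g h := by
      have e : νh = fun k => ∑ r, lam r * TP[lo r, hi r, gg r, k] := funext hdecomp
      rw [e]
      exact slice_sum_TP Finset.univ lam gg lo hi a g h
    rw [show (fun k => (ν k - z * (if k = 0 then (1 : ℝ) else 0)) / (1 - z)) = νh from rfl]
    calc z * (if h = 0 then (1 : ℝ) else 0) + (1 - z) * slice νh a g h
        = z * (if h = 0 then (1 : ℝ) else 0)
            + (1 - z) * ∑ r, lam r * slice (fun k => TP[lo r, hi r, gg r, k]) a g h := by rw [hsl]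
      _ = (∑ r, lam r) * (z * (if h = 0 then (1 : ℝ) else 0))
            + ∑ r, (1 - z) * (lam r * slice (fun k => TP[lo r, hi r, gg r, k]) a g h) := by
          rw [hl1, one_mul, Finset.mul_sum]
      _ = ∑ r, (lam r * (z * (if h = 0 then (1 : ℝ) else 0))
            + (1 - z) * (lam r * slice (fun k => TP[lo r, hi r, gg r, k]) a g h)) := by
          rw [Finset.sum_mul, Finset.sum_add_distrib]
      _ = ∑ r, lam r * (z * (if h = 0 then (1 : ℝ) else 0)
            + (1 - z) * slice (fun k => TP[lo r, hi r, gg r, k]) a g h) :=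
          Finset.sum_congr rfl (fun r _ => by ring)
  refine decAtT_congr (fun h => (hP h).symm) ?_
  refine decAtT_mixture_finset Finset.univ lam _ (fun r _ => hl0 r) hl1 (fun r _ hr => ?_)
  obtain ⟨_, _, hmean, -, -⟩ := hgen r hr
  refine hcell (lo r) (hi r) (gg r) (hlohi r) (hhi r) (hgg r).1 (hgg r).2 ?_
  rw [hmean, hνhmean, mul_div_cancel₀ _ h1z.ne']

end LawDec

end Quant

end Summit.CriticalPhenomena.PercolationContinuityZ3.Theorems
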